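import Summits.Ventures.CertifiedManyBodySolver.Upper.IntervalReaderBoxClasses

/-!
# Ventures/CertifiedManyBodySolver — Upper/IntervalReaderClaimNode.lean: bytes ⇒ THE ROW'S CLAIM NODE
(part 29 of the Theorem-H1′ package; parts 1–28: `IntervalReaderSchur` … `IntervalReaderLimbRowSum`)

HONEST FRAMING: first certified bounds; not a superconductivity verdict; every number certified (two readers)
or labelled float.  This file composes already-landed theorems; it certifies no number, moves no row, and says
nothing about the Hubbard model's spectrum in the thermodynamic limit or about any order parameter.  Its
conclusion is a variational CEILING on a finite-box ground-state energy in a fixed particle-number sector — never an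
order-parameter word (LADDER v1.17 (i)).

WHAT THE ACCEPT WORD CERTIFIES, IN THE TREE'S WORDS.  Parts 17 / 18 / 24 end at the consumers' hypothesis `hE`:
`Re ⟨Ψ, toSpin H Ψ⟩ ≤ E · Re ⟨Ψ, Ψ⟩` for the certificate's own witness `Ψ k = mpsOpenVar N A l r (k ∘ e)`.  The
FORMAT-mps1 rows of record (CERTIFIED #166 / #265 / #299 / #329 / #446 / #447 / #450 / #468 …, the 34 open `t–t′`
boxes and the 15 tori) state their CLAIM NODE one step further, on the Fock side and in a particle-number sector:
`groundEnergy (hubbardOpenBoxTT' a b t t′ U) N₀ ≤ E_upper` (`@[conjecture] def cert_rN_openbox_…`), resp.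
`groundEnergy (hubbardRectTorusTT' a b t t′ U) N₀ ≤ E_upper`.  The step in between is the one
`Theorems/R2cBoxSpinConsumer` takes at `(t, t′, U) = (1, 0, 8)`: Jordan–Wigner transport of the sentence to the Fock
side (`JordanWigner.expect_eq`, `star_toSpinVec_dotProduct`), the sector from the certificate's F-V2 bond-charge
labels (`Upper.mpsOpenVar_eq_zero_of_charge` + `JordanWigner.isNParticle_iff`), and the homogeneous variational
principle `LiebThm1.groundEnergy_mul_norm_le` — which needs the witness norm to be POSITIVE.  The reader supplies
exactly that: its `Nrm`-sweep encloses `Re ⟨Ψ, Ψ⟩` within the printed radius of the printed number, and the code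
ASSERTS the low corner positive before it divides (`h1sweep.py` 0.6.9 l.398, `assert self.n_lo > 0, "norm enclosure
must be positive (raise P)"`) — the hypothesis `hn` below, by value.

* `groundEnergy_le_of_spin_sentence` — for ANY operator `H` on the Fock space of a linearly ordered finite `Λ`, a
  spin-side vector `Φ` supported on total site-charge `N₀` with `0 < Re ⟨Φ, Φ⟩` and
  `Re ⟨Φ, toSpin H Φ⟩ ≤ E · Re ⟨Φ, Φ⟩` gives `groundEnergy H N₀ ≤ E`;
* `re_pos_of_window` — `|B − n̂| ≤ r_n`, `r_n < n̂` ⟹ `0 < B` (the code's assertion, as used);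
* `mpsOpenVar_relabel_eq_zero_of_charge` — F-V2 labels ⟹ the pulled-back witness `Ψ = ψ ∘ (· ∘ e)` is supported on
  total site-charge `N₀` (part 10's relabelling of `Upper.mpsOpenVar_eq_zero_of_charge`);
* `norm_window_of_reader` — the `Nrm`-sweep bytes ⟹ `|Re ⟨Ψ, Ψ⟩ − n̂| ≤ (Σ‖r i‖)²·radN_N` (part 12, identity words);
* `groundEnergy_twoGraph_le_of_reader` / `_den` — THE GENERIC CLAIM NODE: for any two graphs `G₁, G₂` on `Λ` read
  along a monotone enumeration `e` (pulled-back graphs `G₁′, G₂′` on `Fin N`), the `H`-sweep bytes over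
  `twoGraphAutomaton G₁′ G₂′ t t′ U` (resp. the integral automaton at `(d·t, d·t′, d·U)`), the `Nrm`-sweep bytes, the
  by-value ACCEPT test against `E` (resp. `d·E`), the assertion `n_lo > 0`, and F-V2 labels with right label `N₀`
  ⟹ `groundEnergy (hamiltonian G₁ t U + hamiltonian G₂ t′ 0) N₀ ≤ E`;
* the instances for `hubbardOpenBoxTT' a b t t′ U` (34 objects; `den = 4` for the twenty `t′ = −¼` boxes),
  `hubbardRectTorusTT' a b t t′ U` (15 objects) and the `t′ = 0` torus rows' spelling
  `groundEnergyAt (fermionRectTorusGraph a b) t U N₀` — LITERALLY the body shapes of the rows' claim nodes — are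
  part 30, `IntervalReaderClaimNodeRows`.

What remains a hypothesis is unchanged from parts 25–28: the contraction values (kit), the machine premises
(A1)/(A2) with the pinned kernels, and the by-value identity «code tables = `hubbardAutomaton`».
-/

noncomputable section

open Matrix Finset WithLp
open scoped BigOperators ComplexOrder Matrix.Norms.L2Operator

namespace Summit.Ventures.CertifiedManyBodySolver.Upper.IntervalReader

open Literature.MathematicalPhysics.QuantumLattice
open Literature.MathematicalPhysics.QuantumLattice.JordanWigner

/-! ## §QQ  Spin-side sentence ⇒ claim node -/

section SpinSentence

variable {Λ : Type*} [LinearOrder Λ] [Fintype Λ]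

/-- **Spin-side sentence ⇒ the claim node.**  For any operator `H` on the Fock space over the orbitals of a linearly
ordered finite `Λ`, a spin-side vector `Φ` supported on the configurations of total site-charge `N₀`, of POSITIVE
norm, with `Re ⟨Φ, toSpin H Φ⟩ ≤ E · Re ⟨Φ, Φ⟩`, bounds the `N₀`-sector ground-state energy: `groundEnergy H N₀ ≤ E`
(Jordan–Wigner transport `toSpinVec` + `LiebThm1.groundEnergy_mul_norm_le`; the step of
`Theorems/R2cBoxSpinConsumer`, for general `H`). -/
theorem groundEnergy_le_of_spin_sentence (H : Matrix (Finset (Orb Λ)) (Finset (Orb Λ)) ℂ) (N₀ : ℕ)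
    (Φ : TensorIndex Λ 4 → ℂ) (hN : ∀ k : TensorIndex Λ 4, (∑ x, siteCharge (k x)) ≠ N₀ → Φ k = 0)
    (hpos : 0 < (star Φ ⬝ᵥ Φ).re) (E : ℝ)
    (hE : (star Φ ⬝ᵥ (toSpin H *ᵥ Φ)).re ≤ E * (star Φ ⬝ᵥ Φ).re) :
    groundEnergy H N₀ ≤ E := by
  -- the Fock-side vector behind the spin-side one
  set ψ : Fock (Orb Λ) := toSpinVec.symm Φ with hψ
  have hφ : toSpinVec ψ = Φ := by simp [hψ]
  have hψN : IsNParticle N₀ ψ := by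
    rw [isNParticle_iff, hφ]
    exact hN
  have hn : (star ψ ⬝ᵥ ψ).re = (star Φ ⬝ᵥ Φ).re := by
    rw [← star_toSpinVec_dotProduct, hφ]
  have hEψ : (expect H ψ).re ≤ E * (star Φ ⬝ᵥ Φ).re := by
    rw [expect_eq, hφ]
    exact hE
  -- homogeneous variational principle on the `N₀`-particle sector
  have hvar := LiebThm1.groundEnergy_mul_norm_le H hψN
  rw [hn] at hvar
  exact le_of_mul_le_mul_right (hvar.trans hEψ) hpos

/-- **The code's assertion `n_lo > 0`, as used**: an enclosure `|B − n̂| ≤ r_n` with `r_n < n̂` makes `B` positive. -/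
theorem re_pos_of_window {B nh rn : ℝ} (hB : |B - nh| ≤ rn) (hn : rn < nh) : 0 < B := by
  have h := (abs_le.mp hB).1
  linarith

end SpinSentence

/-! ## §RR  The reader's side: charge support and the norm window of the pulled-back witness -/

section ReaderSide

variable {Λ : Type*} [LinearOrder Λ] [Fintype Λ] {N D : ℕ}

omit [LinearOrder Λ] in
/-- **F-V2 labels ⇒ sector, along an enumeration.**  Bond-charge labels `c` of the certificate (left boundary label
`0`, right boundary label `N₀`, every non-zero tensor entry raising the label by the site charge) force the pulled-back
witness `k ↦ mpsOpenVar N A l r (k ∘ e)` to vanish off total site-charge `N₀`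
(`Upper.mpsOpenVar_eq_zero_of_charge` transported by `Equiv.sum_comp`). -/
theorem mpsOpenVar_relabel_eq_zero_of_charge (e : Fin N ≃ Λ) (A : Fin N → MPSTensor 4 D) (l r : Fin D → ℂ)
    (N₀ : ℕ) (c : Fin (N + 1) → Fin D → ℕ)
    (hcl : ∀ α, l α ≠ 0 → c 0 α = 0) (hcr : ∀ β, r β ≠ 0 → c (Fin.last N) β = N₀)
    (hcA : ∀ (j : Fin N) (s : Fin 4) (α β : Fin D), A j s α β ≠ 0 → c j.succ β = c j.castSucc α + siteCharge s) :
    ∀ k : TensorIndex Λ 4, (∑ x, siteCharge (k x)) ≠ N₀ → mpsOpenVar N A l r (fun i => k (e i)) = 0 := by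
  intro k hk
  apply mpsOpenVar_eq_zero_of_charge N A l r N₀ c hcl hcr hcA
  rw [Equiv.sum_comp e (fun x => siteCharge (k x))]
  exact hk

/-- **The norm window of the reader.**  The `Nrm`-sweep bytes (computed environments `YN` with per-step defects
`≤ ρN`, radii `radN` from the exact rank-one boundary obeying the code's recursion with `M = 1`) enclose the real
part of the witness norm: `|Re ⟨Ψ, Ψ⟩ − Re (r† · YN_N · r)| ≤ (Σ‖r i‖)²·radN_N` for `Ψ = ψ ∘ (· ∘ e)`
(part 12's `reader_encloses_productOp_element` with identity words; the norm is relabelling-invariant, part 10). -/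
theorem norm_window_of_reader (e : Fin N ≃ Λ) (A : Fin N → MPSTensor 4 D) (l r : Fin D → ℂ)
    (κ : Fin N → ℝ) (hκ0 : ∀ k, 0 ≤ κ k)
    (hκ : ∀ k (z : EuclideanSpace ℂ (Fin D)), ∑ s, ‖toLp 2 (A k s *ᵥ ofLp z)‖ ^ 2 ≤ κ k * ‖z‖ ^ 2)
    (YN : Fin (N + 1) → Matrix (Fin D) (Fin D) ℂ) (ρN : Fin N → ℝ)
    (hρN : ∀ k : Fin N, ‖YN k.succ - transferOp (A k) 1 (YN k.castSucc)‖ ≤ ρN k)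
    (radN : Fin (N + 1) → ℝ) (hrN0 : ‖YN 0 - vecMulVec (star l) l‖ ≤ radN 0)
    (hrN : ∀ k : Fin N, 1 * κ k * radN k.castSucc + ρN k ≤ radN k.succ) :
    |(star (fun k : TensorIndex Λ 4 => mpsOpenVar N A l r (fun i => k (e i))) ⬝ᵥ
          fun k : TensorIndex Λ 4 => mpsOpenVar N A l r (fun i => k (e i))).re -
        (star r ⬝ᵥ (YN (Fin.last N) *ᵥ r)).re| ≤
      (∑ i, ‖r i‖) * (∑ i, ‖r i‖) * radN (Fin.last N) := by
  have hNrm := reader_encloses_productOp_element N A (fun _ => (1 : Matrix (Fin 4) (Fin 4) ℂ)) κ hκ0 hκ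
    (fun _ => (1 : ℝ)) (fun _ => zero_le_one) (fun _ s => (sum_norm_one_apply_row s).le)
    (fun _ s' => (sum_norm_one_apply_col s').le) (1 : Op (Fin N) 4) one_apply_eq_prod_one l l r r YN ρN
    hρN radN hrN0 hrN
  rw [Matrix.one_mulVec, ← star_compEquiv_dotProduct e] at hNrm
  exact abs_re_sub_re_le_of_norm_sub_le hNrm

end ReaderSide

/-! ## §SS  The generic two-graph CLAIM NODE (den = 1 and den = d) -/

section TwoGraph

variable {Λ : Type*} [LinearOrder Λ] [Fintype Λ] {N D : ℕ}

/-- **THE GENERIC CLAIM NODE — bytes ⇒ `groundEnergy (H_{G₁,t,U} + H_{G₂,t′,0}) N₀ ≤ E`.**  Hypotheses: those of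
part 24's `twoGraph_sentence_of_reader` (the `H`-sweep over `twoGraphAutomaton G₁′ G₂′ t t′ U`, the `Nrm`-sweep,
the by-value ACCEPT test against `E`), the code's by-value assertion `n_lo > 0` (`hn`), and the certificate's F-V2
bond-charge labels with right boundary label `N₀`. -/
theorem groundEnergy_twoGraph_le_of_reader (e : Fin N ≃ Λ) (he : ∀ i j, e i < e j ↔ i < j)
    (G₁ G₂ : SimpleGraph Λ) [DecidableRel G₁.Adj] [DecidableRel G₂.Adj]
    (G₁' G₂' : SimpleGraph (Fin N)) [DecidableRel G₁'.Adj] [DecidableRel G₂'.Adj]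
    (hG₁ : ∀ k k', G₁'.Adj k k' ↔ G₁.Adj (e k) (e k')) (hG₂ : ∀ k k', G₂'.Adj k k' ↔ G₂.Adj (e k) (e k'))
    (t t' U : ℝ) (A : Fin N → MPSTensor 4 D) (l r : Fin D → ℂ)
    (κ : Fin N → ℝ) (hκ0 : ∀ k, 0 ≤ κ k)
    (hκ : ∀ k (z : EuclideanSpace ℂ (Fin D)), ∑ s, ‖toLp 2 (A k s *ᵥ ofLp z)‖ ^ 2 ≤ κ k * ‖z‖ ^ 2)
    (M : Fin N → HState N → HState N → ℝ) (hM0 : ∀ k b' c, 0 ≤ M k b' c)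
    (hMrow : ∀ k b' c s, ∑ s', ‖twoGraphAutomaton G₁' G₂' t t' U k b' c s s'‖ ≤ M k b' c)
    (hMcol : ∀ k b' c s', ∑ s, ‖twoGraphAutomaton G₁' G₂' t t' U k b' c s s'‖ ≤ M k b' c)
    (YH : Fin (N + 1) → HState N → Matrix (Fin D) (Fin D) ℂ) (ρH : Fin N → HState N → ℝ)
    (hρH : ∀ (k : Fin N) (c : HState N),
      ‖YH k.succ c - ∑ b', transferOp (A k) (twoGraphAutomaton G₁' G₂' t t' U k b' c) (YH k.castSucc b')‖ ≤ ρH k c)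
    (radH : Fin (N + 1) → HState N → ℝ)
    (hrH0 : ∀ b', ‖YH 0 b' -
      (Pi.single HState.start (vecMulVec (star l) l) : HState N → Matrix (Fin D) (Fin D) ℂ) b'‖ ≤ radH 0 b')
    (hrH : ∀ (k : Fin N) (c : HState N), ∑ b', M k b' c * κ k * radH k.castSucc b' + ρH k c ≤ radH k.succ c)
    (YN : Fin (N + 1) → Matrix (Fin D) (Fin D) ℂ) (ρN : Fin N → ℝ)
    (hρN : ∀ k : Fin N, ‖YN k.succ - transferOp (A k) 1 (YN k.castSucc)‖ ≤ ρN k)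
    (radN : Fin (N + 1) → ℝ) (hrN0 : ‖YN 0 - vecMulVec (star l) l‖ ≤ radN 0)
    (hrN : ∀ k : Fin N, 1 * κ k * radN k.castSucc + ρN k ≤ radN k.succ)
    (E : ℝ)
    (hlo : (star r ⬝ᵥ (YH (Fin.last N) HState.fin *ᵥ r)).re + (∑ i, ‖r i‖) * (∑ i, ‖r i‖) * radH (Fin.last N)
        HState.fin ≤ E * ((star r ⬝ᵥ (YN (Fin.last N) *ᵥ r)).re - (∑ i, ‖r i‖) * (∑ i, ‖r i‖) * radN (Fin.last N)))
    (hhi : (star r ⬝ᵥ (YH (Fin.last N) HState.fin *ᵥ r)).re + (∑ i, ‖r i‖) * (∑ i, ‖r i‖) * radH (Fin.last N)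
        HState.fin ≤ E * ((star r ⬝ᵥ (YN (Fin.last N) *ᵥ r)).re + (∑ i, ‖r i‖) * (∑ i, ‖r i‖) * radN (Fin.last N)))
    -- the code's by-value assertion `n_lo > 0` (h1sweep.py l.398)
    (hn : (∑ i, ‖r i‖) * (∑ i, ‖r i‖) * radN (Fin.last N) < (star r ⬝ᵥ (YN (Fin.last N) *ᵥ r)).re)
    -- the certificate's F-V2 bond-charge labels
    (N₀ : ℕ) (c : Fin (N + 1) → Fin D → ℕ)
    (hcl : ∀ α, l α ≠ 0 → c 0 α = 0) (hcr : ∀ β, r β ≠ 0 → c (Fin.last N) β = N₀)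
    (hcA : ∀ (j : Fin N) (s : Fin 4) (α β : Fin D), A j s α β ≠ 0 → c j.succ β = c j.castSucc α + siteCharge s) :
    groundEnergy (hamiltonian G₁ t U + hamiltonian G₂ t' 0) N₀ ≤ E := by
  have hE := twoGraph_sentence_of_reader e he G₁ G₂ G₁' G₂' hG₁ hG₂ t t' U A l r κ hκ0 hκ M hM0 hMrow hMcol YH ρH
    hρH radH hrH0 hrH YN ρN hρN radN hrN0 hrN E hlo hhi
  have hB := norm_window_of_reader e A l r κ hκ0 hκ YN ρN hρN radN hrN0 hrN
  exact groundEnergy_le_of_spin_sentence _ N₀ _ (mpsOpenVar_relabel_eq_zero_of_charge e A l r N₀ c hcl hcr hcA)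
    (re_pos_of_window hB hn) E hE

/-- **THE GENERIC CLAIM NODE at `den = d`** (the code runs the INTEGER automaton at `(d·t, d·t′, d·U)` and tests
against `d·E`, `d = den > 0`; part 24's `twoGraph_sentence_of_reader_den`). -/
theorem groundEnergy_twoGraph_le_of_reader_den (d : ℝ) (hd : 0 < d) (e : Fin N ≃ Λ)
    (he : ∀ i j, e i < e j ↔ i < j)
    (G₁ G₂ : SimpleGraph Λ) [DecidableRel G₁.Adj] [DecidableRel G₂.Adj]
    (G₁' G₂' : SimpleGraph (Fin N)) [DecidableRel G₁'.Adj] [DecidableRel G₂'.Adj]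
    (hG₁ : ∀ k k', G₁'.Adj k k' ↔ G₁.Adj (e k) (e k')) (hG₂ : ∀ k k', G₂'.Adj k k' ↔ G₂.Adj (e k) (e k'))
    (t t' U : ℝ) (A : Fin N → MPSTensor 4 D) (l r : Fin D → ℂ)
    (κ : Fin N → ℝ) (hκ0 : ∀ k, 0 ≤ κ k)
    (hκ : ∀ k (z : EuclideanSpace ℂ (Fin D)), ∑ s, ‖toLp 2 (A k s *ᵥ ofLp z)‖ ^ 2 ≤ κ k * ‖z‖ ^ 2)
    (M : Fin N → HState N → HState N → ℝ) (hM0 : ∀ k b' c, 0 ≤ M k b' c)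
    (hMrow : ∀ k b' c s, ∑ s', ‖twoGraphAutomaton G₁' G₂' (d * t) (d * t') (d * U) k b' c s s'‖ ≤ M k b' c)
    (hMcol : ∀ k b' c s', ∑ s, ‖twoGraphAutomaton G₁' G₂' (d * t) (d * t') (d * U) k b' c s s'‖ ≤ M k b' c)
    (YH : Fin (N + 1) → HState N → Matrix (Fin D) (Fin D) ℂ) (ρH : Fin N → HState N → ℝ)
    (hρH : ∀ (k : Fin N) (c : HState N),
      ‖YH k.succ c - ∑ b', transferOp (A k) (twoGraphAutomaton G₁' G₂' (d * t) (d * t') (d * U) k b' c)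
        (YH k.castSucc b')‖ ≤ ρH k c)
    (radH : Fin (N + 1) → HState N → ℝ)
    (hrH0 : ∀ b', ‖YH 0 b' -
      (Pi.single HState.start (vecMulVec (star l) l) : HState N → Matrix (Fin D) (Fin D) ℂ) b'‖ ≤ radH 0 b')
    (hrH : ∀ (k : Fin N) (c : HState N), ∑ b', M k b' c * κ k * radH k.castSucc b' + ρH k c ≤ radH k.succ c)
    (YN : Fin (N + 1) → Matrix (Fin D) (Fin D) ℂ) (ρN : Fin N → ℝ)
    (hρN : ∀ k : Fin N, ‖YN k.succ - transferOp (A k) 1 (YN k.castSucc)‖ ≤ ρN k)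
    (radN : Fin (N + 1) → ℝ) (hrN0 : ‖YN 0 - vecMulVec (star l) l‖ ≤ radN 0)
    (hrN : ∀ k : Fin N, 1 * κ k * radN k.castSucc + ρN k ≤ radN k.succ)
    (E : ℝ)
    (hlo : (star r ⬝ᵥ (YH (Fin.last N) HState.fin *ᵥ r)).re + (∑ i, ‖r i‖) * (∑ i, ‖r i‖) * radH (Fin.last N)
        HState.fin ≤ (d * E) * ((star r ⬝ᵥ (YN (Fin.last N) *ᵥ r)).re -
          (∑ i, ‖r i‖) * (∑ i, ‖r i‖) * radN (Fin.last N)))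
    (hhi : (star r ⬝ᵥ (YH (Fin.last N) HState.fin *ᵥ r)).re + (∑ i, ‖r i‖) * (∑ i, ‖r i‖) * radH (Fin.last N)
        HState.fin ≤ (d * E) * ((star r ⬝ᵥ (YN (Fin.last N) *ᵥ r)).re +
          (∑ i, ‖r i‖) * (∑ i, ‖r i‖) * radN (Fin.last N)))
    (hn : (∑ i, ‖r i‖) * (∑ i, ‖r i‖) * radN (Fin.last N) < (star r ⬝ᵥ (YN (Fin.last N) *ᵥ r)).re)
    (N₀ : ℕ) (c : Fin (N + 1) → Fin D → ℕ)
    (hcl : ∀ α, l α ≠ 0 → c 0 α = 0) (hcr : ∀ β, r β ≠ 0 → c (Fin.last N) β = N₀)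
    (hcA : ∀ (j : Fin N) (s : Fin 4) (α β : Fin D), A j s α β ≠ 0 → c j.succ β = c j.castSucc α + siteCharge s) :
    groundEnergy (hamiltonian G₁ t U + hamiltonian G₂ t' 0) N₀ ≤ E := by
  have hE := twoGraph_sentence_of_reader_den d hd e he G₁ G₂ G₁' G₂' hG₁ hG₂ t t' U A l r κ hκ0 hκ M hM0 hMrow
    hMcol YH ρH hρH radH hrH0 hrH YN ρN hρN radN hrN0 hrN E hlo hhi
  have hB := norm_window_of_reader e A l r κ hκ0 hκ YN ρN hρN radN hrN0 hrN
  exact groundEnergy_le_of_spin_sentence _ N₀ _ (mpsOpenVar_relabel_eq_zero_of_charge e A l r N₀ c hcl hcr hcA)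
    (re_pos_of_window hB hn) E hE

end TwoGraph

end Summit.Ventures.CertifiedManyBodySolver.Upper.IntervalReader

end
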